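import Mathlib
import HarnessLib
import Summits.HubbardSuperconductivity.HubbardSuperconductivity.Theorems.KLProgrammeKLRegimeTwoVolumeTowerBaseTransferDataW
import Summits.HubbardSuperconductivity.HubbardSuperconductivity.Theorems.KLProgrammeKLRegimeTwoVolumeTowerBaseAliveBlockRows
import Summits.HubbardSuperconductivity.HubbardSuperconductivity.Theorems.KLProgrammeKLRegimeTwoVolumeTowerBaseSrcWindowRows
import Summits.HubbardSuperconductivity.HubbardSuperconductivity.Theorems.KLProgrammeKLRegimeTwoVolumeTowerBaseFrameDiffRegime
import Summits.HubbardSuperconductivity.HubbardSuperconductivity.Theorems.KLProgrammeKLRegimeVolumeLimitFlowFramesJets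
import Summits.HubbardSuperconductivity.HubbardSuperconductivity.Theorems.KLProgrammeKLRegimeVolumeLimitV11GridProfileDoors
import Summits.HubbardSuperconductivity.HubbardSuperconductivity.Theorems.KLProgrammeKLRegimeVolumeLimitV11HinstDoors

/-!
# Route `KLProgramme` — crux K3, VL child (stmt-HubbardSuperconductivity-20440), window key «(VL)-SRC-WINDOW» (pen (R235)), atom HB1W (transfer half):
# THE WINDOWED BASE-TRANSFER BUNDLE IS A THEOREM UNDER THE TOWER — every analytic atom of `towerBase_transferDataW_of_atoms` discharged by name
# (seat hubbard-kl-k3c4-p1 g17; suppliers: p3 g18's `aliveBlock_wtRows_klEng6` (p641129), `windowBlock_wtRows_le` (p647382), `klBaseTransfer_frameDiff_rows_klEng3`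
# (FrameDiff chain p642988→p645550), the tower's frame comparison `coeffNorm_fsub_klFlowFrameU_le_of_towerV17F2`, k3c4 g16's `exists_klGridAction_wtProfile_doors` (p641862))

Under the plain key the source half of the base-transfer bundle was UNSATISFIABLE («BASE-SRC-ROWS», p641676: rows `≍ ln M`).  Under the window key every
conjunct is a theorem:
* §1 `klBaseTransferW_sub_eq_klBaseTransfer_sub` — the window block is frame-free, so the frame difference of `klBaseTransferW` IS that of `klBaseTransfer`
  (p3's frame-difference rows apply verbatim); `exists_abs_iteratedDeriv_two_srcWindowFn_le` — `χ` is `C^∞` with support in `[−1,1]`, so `|χ''| ≤ c₂`;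
  `klSrcWindowBlock_wtRows_le` — the `(1 + Λ_T·tnorm)`-weighted rows AND columns of `klSrcWindowBlock·S_{4M}` are `≤ 1 + 32·c₂` (p3's `windowBlock_wtRows_le`
  at `F := srcWindowFamily`, read through the slot-`0` test of `klSrcWindowBlock_mul_apply`; columns by the slot-`0` re-indexing `Y ↦ (Y.1, ((0, spin), charge))`);
* §2 **`hbaseW_of_towerP`** — for every `(G, P, Q, R)` with `R.WF2`: thresholds `c ≤ min (klEngC₃6 P R) c₉`, `U ≤ min (klEngU₀6 P R c) U₉`; under
  `TowerP klPredsV17F2 …` the seven conjuncts of the windowed bundle hold at every instance `L ≥ L₂`, `M ≥ M₂ L b`, at the flow frames, with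
  `Λ_T = Λg = 1`, `cgW = 2(klIsoT + 4(klE4X0+1)) + (1 + 32c₂)`, grid profiles `NG`, and frame-mismatch rate
  `δg L = Cfd·(|A₀|+|A₁|+|A₂|)/L → 0` (`A_r = Σ_{m ≤ n_β} 4(2d_m+1)(1+4d_m)^r·Q.CL β m` from the tower's frame comparison) — the HbaseW half of HB1W.

Proofs only; no definition; nothing asserts HB1W, Hgrid‴, any stub, K3, VL or superconductivity.
[cite: BenfattoGiulianiMastropietro2006, §2.7 (2.70)–(2.71a), §2.9 (4.6)-(4.8), §3 (3.3)]
-/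

noncomputable section

namespace Summit.HubbardSuperconductivity.HubbardSuperconductivity.Theorems.TwoVolumeSource

set_option linter.dupNamespace false -- summit = problem name (single-conjunct summit), D-0017

open Finset Filter Topology Literature.MathematicalPhysics.QuantumLattice GrassmannAlgebra Literature.Probability.LatticeModels
  Literature.Probability.LatticeModels.BattleFederbush
open Summit.HubbardSuperconductivity.HubbardSuperconductivity.Theorems.TwoPointAssembly
open Summit.HubbardSuperconductivity.HubbardSuperconductivity.Theorems.KLRegimeSplit
open Summit.HubbardSuperconductivity.HubbardSuperconductivity.Theorems.KLProgrammeLegKernels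
open Summit.HubbardSuperconductivity.HubbardSuperconductivity.Theorems.EngineV8
open Summit.HubbardSuperconductivity.HubbardSuperconductivity.Theorems.TwoVolumeDefect
open Summit.HubbardSuperconductivity.HubbardSuperconductivity.Theorems.TorusFourierL2

/-! ## §1 The three window-specific facts -/

section Facts

variable {V M : ℕ} [NeZero V]

/-- **The frame difference of the windowed base transfer is the frame difference of the plain base transfer** (the source blocks are frame-free).
[folklore] -/
theorem klBaseTransferW_sub_eq_klBaseTransfer_sub (β μ : ℝ) (K' K : TrigPolyC4v) (p' : SrcLabel V M 0) (p : GridLeg (GridPoint V (klGridN M)) × Fin 2) :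
    klBaseTransferW V M β μ K' p' p - klBaseTransferW V M β μ K p' p = klBaseTransfer V M β μ K' p' p - klBaseTransfer V M β μ K p' p := by
  rw [klBaseTransferW_sub_apply, klBaseTransfer_sub_apply]

/-- **The window has a bounded second derivative**: `χ` is `C^∞` and vanishes off `[−1, 1]`. [folklore] -/
theorem exists_abs_iteratedDeriv_two_srcWindowFn_le : ∃ c₂ : ℝ, ∀ x : ℝ, |iteratedDeriv 2 srcWindowFn x| ≤ c₂ := by
  have hsupp : HasCompactSupport srcWindowFn := by
    refine HasCompactSupport.intro (K := Set.Icc (-1 : ℝ) 1) isCompact_Icc fun x hx => ?_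
    refine srcWindowFn_eq_zero ?_
    simp only [Set.mem_Icc, not_and_or, not_le] at hx
    rcases hx with h | h
    · rw [abs_of_neg (by linarith)]; linarith
    · rw [abs_of_pos (by linarith)]; linarith
  have hsupp2 : HasCompactSupport (iteratedDeriv 2 srcWindowFn) := by
    rw [show (2 : ℕ) = 1 + 1 from rfl, iteratedDeriv_succ, iteratedDeriv_one]
    exact hsupp.deriv.deriv
  have hcont : Continuous (iteratedDeriv 2 srcWindowFn) := ContDiff.continuous_iteratedDeriv' 2 contDiff_srcWindowFn
  obtain ⟨C, hC⟩ := hsupp2.exists_bound_of_continuous hcont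
  exact ⟨C, fun x => by simpa only [Real.norm_eq_abs] using hC x⟩

variable [NeZero M]

/-- **The weighted rows AND columns of the windowed source block `klSrcWindowBlock·S_{4M}` are `≤ 1 + 32·c₂`** (`β > 0`, any `Λ_T ≥ 0`, `c₂` a bound
on `|χ''|`): p3 g18's `windowBlock_wtRows_le` at `F := srcWindowFamily` read through the slot-`0` test. [cite: BenfattoGiulianiMastropietro2006, §3 (3.2)–(3.8)] -/
theorem klSrcWindowBlock_wtRows_le {β : ℝ} (hβ : 0 < β) {c₂ : ℝ} (hc₂ : ∀ x : ℝ, |iteratedDeriv 2 srcWindowFn x| ≤ c₂) {ΛT : ℝ} (hΛT : 0 ≤ ΛT) :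
    (∀ Y : SpaceTimeIdx V M × SectorLeg (sectorCount 0), ∑ y : GridLeg (GridPoint V (klGridN M)),
      ‖(klSrcWindowBlock V M β * hubbardGridSub V M β (klGridN M)) Y y‖ * (1 + ΛT * (Torus.tnorm (Y.1.2 - y.1.1.2) : ℝ)) ≤ 1 + 32 * c₂) ∧
    (∀ y : GridLeg (GridPoint V (klGridN M)), ∑ Y : SpaceTimeIdx V M × SectorLeg (sectorCount 0),
      ‖(klSrcWindowBlock V M β * hubbardGridSub V M β (klGridN M)) Y y‖ * (1 + ΛT * (Torus.tnorm (Y.1.2 - y.1.1.2) : ℝ)) ≤ 1 + 32 * c₂) := by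
  classical
  have hχ1 : ∀ x, |srcWindowFn x| ≤ 1 := fun x => by
    have h := srcWindowFn_mem_Icc x
    rw [abs_of_nonneg h.1]; exact h.2
  have hχ0 : ∀ x, 1 ≤ |x| → srcWindowFn x = 0 := fun x hx => srcWindowFn_eq_zero hx
  obtain ⟨hrow, hcol⟩ := windowBlock_wtRows_le (V := V) (M := M) hβ (contDiff_srcWindowFn (n := 2)) hc₂ hχ1 hχ0
    (F := srcWindowFamily V M) (fun ω k => srcWindowFamily_apply V M ω k) hΛT
  have hc0 : 0 ≤ c₂ := le_trans (abs_nonneg _) (hc₂ 0)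
  -- the windowed source block read at `Y` is `(ε • E(F_χ))·S` at the slot-`0` relabelling of `Y`, or `0`
  set φ : SpaceTimeIdx V M × SectorLeg (sectorCount 0) → SpaceTimeIdx V M × SectorLeg 1 := fun Y => (Y.1, (((0 : Fin 1), Y.2.1.2), Y.2.2)) with hφ
  have hentry : ∀ (Y : SpaceTimeIdx V M × SectorLeg (sectorCount 0)) (y : GridLeg (GridPoint V (klGridN M))),
      (klSrcWindowBlock V M β * hubbardGridSub V M β (klGridN M)) Y y =
        if (Y.2.1.1 : ℕ) = 0 then ((((imagTimeWeight β M : ℝ) : ℂ) • sectorAnalysisMatrix V M β (srcWindowFamily V M)) * hubbardGridSub V M β (klGridN M)) (φ Y) y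
        else 0 := by
    intro Y y
    rw [klSrcWindowBlock_mul_apply, Matrix.smul_mul, Matrix.smul_apply, smul_eq_mul]
  refine ⟨fun Y => ?_, fun y => ?_⟩
  · by_cases h0 : (Y.2.1.1 : ℕ) = 0
    · have h := hrow (φ Y)
      simp only [hentry, h0, if_true]
      exact h
    · simp only [hentry, h0, if_false, norm_zero, zero_mul, sum_const_zero]
      linarith
  · -- columns: restrict to slot `0` and re-index by the injection `φ`
    let g : SpaceTimeIdx V M × SectorLeg 1 → ℝ := fun Y' =>
      ‖((((imagTimeWeight β M : ℝ) : ℂ) • sectorAnalysisMatrix V M β (srcWindowFamily V M)) * hubbardGridSub V M β (klGridN M)) Y' y‖ *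
        (1 + ΛT * (Torus.tnorm (Y'.1.2 - y.1.1.2) : ℝ))
    have hg0 : ∀ Y', 0 ≤ g Y' := fun Y' => by positivity
    let S0 : SpaceTimeIdx V M × SectorLeg (sectorCount 0) → Prop := fun Y => (Y.2.1.1 : ℕ) = 0
    have hterm : ∀ Y, ‖(klSrcWindowBlock V M β * hubbardGridSub V M β (klGridN M)) Y y‖ * (1 + ΛT * (Torus.tnorm (Y.1.2 - y.1.1.2) : ℝ)) =
        if S0 Y then g (φ Y) else 0 := by
      intro Y
      by_cases h0 : (Y.2.1.1 : ℕ) = 0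
      · simp only [hentry, h0, if_true, S0, g, hφ]
      · simp only [hentry, h0, if_false, norm_zero, zero_mul, S0]
    have hinj : ∀ Y₁ ∈ univ.filter S0, ∀ Y₂ ∈ univ.filter S0, φ Y₁ = φ Y₂ → Y₁ = Y₂ := by
      intro Y₁ h₁ Y₂ h₂ h
      have hs₁ : (Y₁.2.1.1 : ℕ) = 0 := (mem_filter.1 h₁).2
      have hs₂ : (Y₂.2.1.1 : ℕ) = 0 := (mem_filter.1 h₂).2
      simp only [hφ, Prod.mk.injEq] at h
      obtain ⟨hx, ⟨-, hsp⟩, hc⟩ := h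
      have hsl : Y₁.2.1.1 = Y₂.2.1.1 := Fin.ext (by rw [hs₁, hs₂])
      exact Prod.ext hx (Prod.ext (Prod.ext hsl hsp) hc)
    calc ∑ Y, ‖(klSrcWindowBlock V M β * hubbardGridSub V M β (klGridN M)) Y y‖ * (1 + ΛT * (Torus.tnorm (Y.1.2 - y.1.1.2) : ℝ))
        = ∑ Y, (if S0 Y then g (φ Y) else 0) := sum_congr rfl fun Y _ => hterm Y
      _ = ∑ Y ∈ univ.filter S0, g (φ Y) := by rw [sum_filter]
      _ = ∑ Y' ∈ (univ.filter S0).image φ, g Y' := (sum_image hinj).symm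
      _ ≤ ∑ Y', g Y' := sum_le_sum_of_subset_of_nonneg (subset_univ _) fun Y' _ _ => hg0 Y'
      _ ≤ (1 : ℕ) * (1 + 32 * c₂) := hcol y
      _ = 1 + 32 * c₂ := by rw [Nat.cast_one, one_mul]

end Facts

/-! ## §2 The windowed base-transfer bundle under the tower -/

set_option maxHeartbeats 1600000 in -- long binders and threshold bookkeeping
/-- **THE WINDOWED BASE-TRANSFER BUNDLE IS A THEOREM UNDER THE TOWER** (see the module docstring): for every `(G, P, Q, R)` with `P.WF`, `R.WF2`, at the
registration thresholds, for every `TowerP klPredsV17F2 …`: volume-free constants `Λ_T = Λg = 1`, `cgW`, `NG`, cap `δgb`, rate `δg → 0`, and thresholds `L₂`,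
`M₂ L b` such that the seven conjuncts of the windowed base-transfer bundle (`hdata` of `…TowerBaseW.tower_baseW_keyedDefectTSW_eventually_le` at the flow frames)
hold at every instance.  [cite: BenfattoGiulianiMastropietro2006, §2.7 (2.70)–(2.71a), §3 (3.3)] -/
theorem hbaseW_of_towerP (G : GeoConsts) (P : SplitConsts) (Q : EngConsts) (R : RenConsts) (hP : P.WF) (hR2 : R.WF2) :
    ∃ c₇ : ℝ, 0 < c₇ ∧ ∀ c : ℝ, 0 < c → c ≤ c₇ → ∃ U₇ : ℝ, 0 < U₇ ∧
      ∀ μ ∈ klWindowC, ∀ U : ℝ, 0 < U → U ≤ U₇ → ∀ β : ℝ, klBetaMin ≤ β → β ≤ Real.exp (c / U ^ 2) →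
        ∀ (K : TrigPolyC4v) (Lstar : ℕ) (Mstar : ℕ → ℕ), TowerP klPredsV17F2 G P Q R β U μ K Lstar Mstar →
        ∃ (ΛgT cgW Λg δgb : ℝ) (NG : ℕ → ℝ) (δg : ℕ → ℝ), 0 < ΛgT ∧ 0 ≤ cgW ∧ 0 < Λg ∧ (∀ k, 0 ≤ NG k) ∧ (∀ L, 0 ≤ δg L ∧ δg L ≤ δgb) ∧
          Tendsto δg atTop (𝓝 0) ∧
        ∃ L₂ : ℕ, ∃ M₂ : ℕ → ℕ → ℕ, ∀ (L b M : ℕ) [NeZero L] [NeZero (b * L)] [NeZero M], L₂ ≤ L → M₂ L b ≤ M →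
          (∀ x : SrcLabel (b * L) M 0, ∑ y, ‖klBaseTransferW (b * L) M β μ (klFlowFrameU L M β U μ (nScales β + 1)) x y‖ * (1 + ΛgT * (Torus.tnorm (x.1.1.2 - y.1.1.1.2) : ℝ)) ≤ cgW) ∧
          (∀ y : GridLeg (GridPoint (b * L) (klGridN M)) × Fin 2, ∑ x, ‖klBaseTransferW (b * L) M β μ (klFlowFrameU L M β U μ (nScales β + 1)) x y‖ * (1 + ΛgT * (Torus.tnorm (x.1.1.2 - y.1.1.1.2) : ℝ)) ≤ cgW) ∧
          (∀ (δ' β' β₁ : Fin 2 → Fin b) (xbar : SrcLabel L M 0) (y : GridLeg (GridPoint L (klGridN M)) × Fin 2),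
            ‖klBaseTransferW (b * L) M β μ (klFlowFrameU L M β U μ (nScales β + 1)) ((klBlockEquivD L b M 0).symm (β' + δ', xbar)) ((klGridBlockEquivD L b M).symm (β₁ + δ', y))‖ =
              ‖klBaseTransferW (b * L) M β μ (klFlowFrameU L M β U μ (nScales β + 1)) ((klBlockEquivD L b M 0).symm (β', xbar)) ((klGridBlockEquivD L b M).symm (β₁, y))‖) ∧
          (∀ x, ∑ y, ‖klBaseTransferW (b * L) M β μ (klFlowFrameU (b * L) M β U μ (nScales β + 1)) x y - klBaseTransferW (b * L) M β μ (klFlowFrameU L M β U μ (nScales β + 1)) x y‖ ≤ δg L) ∧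
          (∀ y, ∑ x, ‖klBaseTransferW (b * L) M β μ (klFlowFrameU (b * L) M β U μ (nScales β + 1)) x y - klBaseTransferW (b * L) M β μ (klFlowFrameU L M β U μ (nScales β + 1)) x y‖ ≤ δg L) ∧
          (∀ (k : ℕ) (p : Fin k) (y : GridLeg (GridPoint L (klGridN M))),
            ∑ Y ∈ univ.filter (fun Y : Fin k → GridLeg (GridPoint L (klGridN M)) => Y p = y),
              ‖kernel ℂ (klGridAction L M β U μ (klFlowFrameU L M β U μ (nScales β + 1))) k Y‖ *
                (1 + labelDiam (fun Y₁ Y₂ : GridLeg (GridPoint L (klGridN M)) => Λg * (Torus.tnorm (Y₁.1.1.2 - Y₂.1.1.2) : ℝ)) (univ.image Y)) ≤ imagTimeWeight β M * NG k) ∧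
          (∀ (k : ℕ) (p : Fin k) (y : GridLeg (GridPoint (b * L) (klGridN M))),
            ∑ Y ∈ univ.filter (fun Y : Fin k → GridLeg (GridPoint (b * L) (klGridN M)) => Y p = y),
              ‖kernel ℂ (klGridAction (b * L) M β U μ (klFlowFrameU (b * L) M β U μ (nScales β + 1))) k Y‖ *
                (1 + labelDiam (fun Y₁ Y₂ : GridLeg (GridPoint (b * L) (klGridN M)) => Λg * (Torus.tnorm (Y₁.1.1.2 - Y₂.1.1.2) : ℝ)) (univ.image Y)) ≤ imagTimeWeight β M * NG k) := by
  classical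
  obtain ⟨c₉, U₉, hc₉, hU₉, NG, hNG0, hgrid⟩ := exists_klGridAction_wtProfile_doors R hR2.wf
  obtain ⟨c₂, hc₂⟩ := exists_abs_iteratedDeriv_two_srcWindowFn_le
  have hc20 : 0 ≤ c₂ := le_trans (abs_nonneg _) (hc₂ 0)
  refine ⟨min (klEngC₃6 P R) c₉, lt_min (klEngC₃6_pos P R) hc₉, fun c hc hcc => ?_⟩
  have hc6 : c ≤ klEngC₃6 P R := hcc.trans (min_le_left _ _)
  have hc9 : c ≤ c₉ := hcc.trans (min_le_right _ _)
  have hc3 : c ≤ klEngC₃3 P R := hc6.trans (klEngC₃6_le_klEngC₃3 P R)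
  refine ⟨min (klEngU₀6 P R c) U₉, lt_min (klEngU₀6_pos P R c) hU₉, fun μ hμ U hU hUU β hβmin hβc K Lstar Mstar hT => ?_⟩
  have hU6 : U ≤ klEngU₀6 P R c := hUU.trans (min_le_left _ _)
  have hU9 : U ≤ U₉ := hUU.trans (min_le_right _ _)
  have hU3 : U ≤ klEngU₀3 P R c := hU6.trans (klEngU₀6_le_klEngU₀3 P R c)
  have hβ : 0 < β := KLRegimeSplit.pos_of_klBetaMin_le hβmin
  have hn1 : 1 ≤ nScales β + 1 := Nat.le_add_left 1 _
  -- the frame-difference rows (p3 g18's FrameDiff chain at the engine thresholds)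
  obtain ⟨Cfd, hCfd0, hfd⟩ := klBaseTransfer_frameDiff_rows_klEng3 P hR2.wf hc hc3 hU hU3 hμ hβmin hβc
  -- the tower's frame comparison numerators (orders `0, 1, 2`)
  set A : ℕ → ℝ := fun r => ∑ m ∈ range (nScales β + 1), 4 * (2 * klFlowDeg m + 1) * (1 + 4 * klFlowDeg m) ^ r * Q.CL β m with hA
  set Aabs : ℝ := |A 0| + |A 1| + |A 2| with hAabs
  have hAabs0 : 0 ≤ Aabs := by positivity
  have hAj : ∀ j ≤ 2, |A j| ≤ Aabs := by
    intro j hj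
    have h0 := abs_nonneg (A 0); have h1 := abs_nonneg (A 1); have h2 := abs_nonneg (A 2)
    interval_cases j <;> simp only [hAabs] <;> linarith
  -- the alive constant (p3 g18's `aliveBlock_wtRows_klEng6` at `Λ_T = 1`) and the window constant
  set cA : ℝ := 2 * (klIsoT + 4 * 1 * (klE4X0 + 1)) with hcA
  set cB : ℝ := 1 + 32 * c₂ with hcB
  have hcB0 : 0 ≤ cB := by positivity
  refine ⟨1, cA + cB, 1, Cfd * Aabs, NG, fun L => Cfd * (Aabs / L), one_pos, ?_, one_pos, hNG0, fun L => ⟨by positivity, ?_⟩, ?_,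
    max Lstar (klEngL₃ β U),
    fun L b => max (max (Mstar L) (Mstar (b * L))) (max (max (klEngM₃ β U L) (klEngM₃ β U (b * L))) (max (Q.M0 β L) (Q.M0 β (b * L)))),
    fun L b M _ _ _ hL hM => ?_⟩
  · -- `0 ≤ cgW`: the alive constant is nonnegative (first conjunct of the alive lemma is not yet available, so directly)
    have hA0 : 0 ≤ cA := by
      have := aliveBlock_cgW_nonneg (zero_le_one : (0 : ℝ) ≤ 1)
      rw [hcA]; positivity
    positivity
  · -- `δg L ≤ δgb`
    refine mul_le_mul_of_nonneg_left ?_ hCfd0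
    rcases Nat.eq_zero_or_pos L with hL0 | hLpos
    · rw [hL0, Nat.cast_zero, div_zero]; exact hAabs0
    · exact div_le_self hAabs0 (by exact_mod_cast hLpos)
  · -- `δg → 0`
    simpa using (tendsto_const_div_atTop_nhds_zero_nat Aabs).const_mul Cfd
  -- one instance
  dsimp only at hM
  have hLs : Lstar ≤ L := le_trans (le_max_left _ _) hL
  have hL3 : klEngL₃ β U ≤ L := le_trans (le_max_right _ _) hL
  have hMs : Mstar L ≤ M := by omega
  have hMsb : Mstar (b * L) ≤ M := by omega
  have hM3 : klEngM₃ β U L ≤ M := by omega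
  have hM3b : klEngM₃ β U (b * L) ≤ M := by omega
  have hMQ : Q.M0 β L ≤ M := by omega
  have hMQb : Q.M0 β (b * L) ≤ M := by omega
  have hb1 : 1 ≤ b := Nat.pos_of_ne_zero fun hb => NeZero.ne (b * L) (by rw [hb, Nat.zero_mul])
  have hLbL : L ≤ b * L := Nat.le_mul_of_pos_left L hb1
  -- the admissible flow frames of the two volumes
  have hK : FrameOK R U (nScales β) μ (klFlowFrameU L M β U μ (nScales β + 1)) :=
    frameOK_klFlowFrameU_of_histP_le hR2 hn1 le_rfl le_rfl (histP_top_of_towerP hT hLs hMs)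
  have hKb : FrameOK R U (nScales β) μ (klFlowFrameU (b * L) M β U μ (nScales β + 1)) :=
    frameOK_klFlowFrameU_of_histP_le hR2 hn1 le_rfl le_rfl (histP_top_of_towerP hT (hLs.trans hLbL) hMsb)
  -- (i) the alive block of the fine volume at the coarse frame
  obtain ⟨-, hArow, hAcol⟩ := aliveBlock_wtRows_klEng6 (V := b * L) (M := M) (K := klFlowFrameU L M β U μ (nScales β + 1))
    hP hR2 hc hc6 hμ hU hU6 hβmin hβc hK (hL3.trans hLbL) hM3b (zero_le_one : (0 : ℝ) ≤ 1)
  -- (window) the windowed source block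
  obtain ⟨hBrow, hBcol⟩ := klSrcWindowBlock_wtRows_le (V := b * L) (M := M) hβ hc₂ (zero_le_one : (0 : ℝ) ≤ 1)
  have hA0 : 0 ≤ cA := by
    have := aliveBlock_cgW_nonneg (zero_le_one : (0 : ℝ) ≤ 1); rw [hcA]; positivity
  have hArow' : ∀ Y : SpaceTimeIdx (b * L) M × SectorLeg (sectorCount 0), ∑ y : GridLeg (GridPoint (b * L) (klGridN M)),
      ‖((((imagTimeWeight β M : ℝ) : ℂ) • sectorAnalysisMatrix (b * L) M β (klAnisoFamily (b * L) M β μ (klFlowFrameU L M β U μ (nScales β + 1)) klE0 0)) *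
          hubbardGridSub (b * L) M β (klGridN M)) Y y‖ * (1 + 1 * (Torus.tnorm (Y.1.2 - y.1.1.2) : ℝ)) ≤ cA + cB :=
    fun Y => (hArow Y).trans (le_add_of_nonneg_right hcB0)
  have hAcol' : ∀ y : GridLeg (GridPoint (b * L) (klGridN M)), ∑ Y : SpaceTimeIdx (b * L) M × SectorLeg (sectorCount 0),
      ‖((((imagTimeWeight β M : ℝ) : ℂ) • sectorAnalysisMatrix (b * L) M β (klAnisoFamily (b * L) M β μ (klFlowFrameU L M β U μ (nScales β + 1)) klE0 0)) *
          hubbardGridSub (b * L) M β (klGridN M)) Y y‖ * (1 + 1 * (Torus.tnorm (Y.1.2 - y.1.1.2) : ℝ)) ≤ cA + cB :=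
    fun y => (hAcol y).trans (le_add_of_nonneg_right hcB0)
  have hBrow' : ∀ Y : SpaceTimeIdx (b * L) M × SectorLeg (sectorCount 0), ∑ y : GridLeg (GridPoint (b * L) (klGridN M)),
      ‖(klSrcWindowBlock (b * L) M β * hubbardGridSub (b * L) M β (klGridN M)) Y y‖ * (1 + 1 * (Torus.tnorm (Y.1.2 - y.1.1.2) : ℝ)) ≤ cA + cB :=
    fun Y => (hBrow Y).trans (le_add_of_nonneg_left hA0)
  have hBcol' : ∀ y : GridLeg (GridPoint (b * L) (klGridN M)), ∑ Y : SpaceTimeIdx (b * L) M × SectorLeg (sectorCount 0),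
      ‖(klSrcWindowBlock (b * L) M β * hubbardGridSub (b * L) M β (klGridN M)) Y y‖ * (1 + 1 * (Torus.tnorm (Y.1.2 - y.1.1.2) : ℝ)) ≤ cA + cB :=
    fun y => (hBcol y).trans (le_add_of_nonneg_left hA0)
  -- (ii) the frame mismatch: tower comparison of the two flow frames, read by p3's frame-difference rows (plain = windowed difference)
  have hcoeff : ∀ j ≤ 2, (fsub (klFlowFrameU L M β U μ (nScales β + 1)) (klFlowFrameU (b * L) M β U μ (nScales β + 1))).coeffNorm j ≤ Aabs / L := by
    intro j hj
    have h := coeffNorm_fsub_klFlowFrameU_le_of_towerV17F2 hμ hT hLs hLbL hMs hMQ hMsb hMQb (n := nScales β + 1) le_rfl j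
    refine h.trans ?_
    have hL0 : (0 : ℝ) ≤ L := Nat.cast_nonneg L
    calc (∑ m ∈ range (nScales β + 1), 4 * (2 * klFlowDeg m + 1) * (1 + 4 * klFlowDeg m) ^ j * Q.CL β m) / L = A j / L := by rw [hA]
      _ ≤ |A j| / L := div_le_div_of_nonneg_right (le_abs_self _) hL0
      _ ≤ Aabs / L := div_le_div_of_nonneg_right (hAj j hj) hL0
  obtain ⟨hfrow, hfcol⟩ := hfd (b * L) M (hL3.trans hLbL) hM3b (klFlowFrameU (b * L) M β U μ (nScales β + 1)) (klFlowFrameU L M β U μ (nScales β + 1))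
    hKb hK (Aabs / L) hcoeff
  -- (iii) the grid profiles under the doors
  have hGc := hgrid (V := L) (M := M) hK hβmin hc.le hc9 hβc hU hU9 hL3 hM3
  have hGf := hgrid (V := b * L) (M := M) hKb hβmin hc.le hc9 hβc hU hU9 (hL3.trans hLbL) hM3b
  refine ⟨sum_norm_klBaseTransferW_mul_wt_row_le β μ _ 1 (cA + cB) hArow' hBrow', sum_norm_klBaseTransferW_mul_wt_col_le β μ _ 1 (cA + cB) hAcol' hBcol',
    klBaseTransferW_blockCovariant hβ.ne' μ _, fun x => ?_, fun y => ?_, hGc, hGf⟩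
  · calc ∑ y, ‖klBaseTransferW (b * L) M β μ (klFlowFrameU (b * L) M β U μ (nScales β + 1)) x y -
          klBaseTransferW (b * L) M β μ (klFlowFrameU L M β U μ (nScales β + 1)) x y‖
        = ∑ y, ‖klBaseTransfer (b * L) M β μ (klFlowFrameU L M β U μ (nScales β + 1)) x y -
            klBaseTransfer (b * L) M β μ (klFlowFrameU (b * L) M β U μ (nScales β + 1)) x y‖ :=
          sum_congr rfl fun y _ => by rw [klBaseTransferW_sub_eq_klBaseTransfer_sub, norm_sub_rev]
      _ ≤ Cfd * (Aabs / L) := hfrow x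
  · calc ∑ x, ‖klBaseTransferW (b * L) M β μ (klFlowFrameU (b * L) M β U μ (nScales β + 1)) x y -
          klBaseTransferW (b * L) M β μ (klFlowFrameU L M β U μ (nScales β + 1)) x y‖
        = ∑ x, ‖klBaseTransfer (b * L) M β μ (klFlowFrameU L M β U μ (nScales β + 1)) x y -
            klBaseTransfer (b * L) M β μ (klFlowFrameU (b * L) M β U μ (nScales β + 1)) x y‖ :=
          sum_congr rfl fun x _ => by rw [klBaseTransferW_sub_eq_klBaseTransfer_sub, norm_sub_rev]
      _ ≤ Cfd * (Aabs / L) := hfcol y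

end Summit.HubbardSuperconductivity.HubbardSuperconductivity.Theorems.TwoVolumeSource

end
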